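import Summits.ResolutionOfSingularities.ResolutionOfSingularities.Theorems.PurelyInseparableDim4UnitClassTransfer
import Summits.ResolutionOfSingularities.ResolutionOfSingularities.Theorems.PurelyInseparableDim4TschirnhausJetStep
import HarnessLib
import HarnessLib.Audit.Tags

/-!
# Purely inseparable four-folds — lemmas for «UnitClassOrder»: degrees under `≤`, supports of the powers of the translation
# part, coefficients through a re-presentation, and THE COEFFICIENT ONE FACTOR `G` BELOW THE TOP of `E · (x_f e_f + G)^d`
# (cell `res-dim4-pi`, K2(p) lane, slice B, brick «UnitClassOrder», FILE A1)

[OURS · counted 0 · cell `res-dim4-pi` · K2(p) lane (holder res-dim4-p-12 g3, scope word 2026-08-29T04:43:23Z) · seat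
res-dim4-p-7 g4 · consumer res-dim4-p-1 g4 (K24a-R1′(β) `R1c`, «s = 3 is exactly what R1c consumes», 04:39:13Z).]  Nothing
here proves K2(p)/K2(5), `NoIsolatedTrap p p`, or resolution of singularities in dimension ≥ 4 / characteristic `p`.  AI
kernel work, weaker than expert review.

Setting (SN3/SN3b letters, as in `…UnitClassTransfer`): `θ(x_{π i}) = x_i · e_i` (`i ≠ f`), `θ(x_{π f}) = x_f · e_f + G`,
`e_i(0) ≠ 0`, `G(0) = 0`, no `x_f`-term in `G`; a re-presentation `F_B = clean_q(V · θ F_A) + D`, `V(0) ≠ 0`, `D ∈ 𝔪₀ᴹ`.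
`F_A` is PRESENTED with boundary `r` (`r (π f) = 0`) and a residual of order `d` whose degree-`d` part is the pure power
`a · x_{π f}^d` (STRAIGHT at `π f`); `n♯ = n.mapDomain π⁻¹`, `r♯` the transported boundary.

* §1 small facts: degrees under `≤` (with p-1's `FrameChange.eq_of_le_of_degree_le`), products with a factor vanishing below an exponent, supports of powers of `G`, the
  remainder `F_A − a·x^{r + d·e_{πf}} ∈ 𝔪₀^{|r|+d+1}`, coefficients through the re-presentation (`coeff_of_rel_of_lower`).
* §2 `coeff_pred_mul_X_mul_add_pow`: the coefficient of `x_f^{d-1} · x^w` (`w` off `f`) in `E · (x_f e_f + G)^d` is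
  `d · E(0) · e_f(0)^{d-1} · coeff_w G` as soon as `G` vanishes below `|w|` and the terms with `≥ 2` factors `G` miss it.
The theorems «straight at both ends ⇒ `s = 2`», «Tschirnhaus at degree `d+1` at both ends ⇒ `s = 3`» are FILE A2
(`…UnitClassOrder`).  `d`-generic, characteristic-free.
[cite: Abhyankar1990, Lecture 25 pp. 216–217] [cite: Hauser2010, §§F–G (cleaning)] [folklore]
bears_on: LADDER-RESOLUTION:D157-DOOR2 (res-dim4-pi · K2(p) · slice B · UnitClassOrder A1).  Supports
stmt-ResolutionOfSingularities-16155 (helper).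
-/

set_option linter.dupNamespace false -- mandated namespace of this single-conjunct summit

noncomputable section

namespace Summit.ResolutionOfSingularities.ResolutionOfSingularities.Theorems.PIDim4

namespace SwapNorm

open MvPolynomial Finset
open Literature.AlgebraicGeometry.Resolution
open Literature.AlgebraicGeometry.Resolution.Hauser2010

variable {K : Type} [Field K]

/-! ## §1 Small facts -/

/-- A proper divisor of an exponent has smaller degree. [folklore] -/
theorem degree_lt_of_le_of_ne {m n : Fin 4 →₀ ℕ} (hle : m ≤ n) (hne : m ≠ n) : m.degree < n.degree := by
  rw [Finsupp.degree_eq_sum, Finsupp.degree_eq_sum]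
  have h : ∃ l, m l < n l := by
    by_contra h
    push Not at h
    exact hne (Finsupp.ext fun l => le_antisymm (Finsupp.le_def.mp hle l) (h l))
  obtain ⟨l, hl⟩ := h
  exact sum_lt_sum (fun i _ => Finsupp.le_def.mp hle i) ⟨l, mem_univ l, hl⟩

/-! `m ≤ n` with `|n| ≤ |m|` forces `m = n`: res-dim4-p-1 g3's `FrameChange.eq_of_le_of_degree_le` (`…TschirnhausJetStep`),
imported. -/

/-- If `Q` has no monomial `≤ t`, neither has `H · Q` the monomial `t`. [folklore] -/
theorem coeff_mul_eq_zero_of_forall_le {H Q : MvPolynomial (Fin 4) K} {t : Fin 4 →₀ ℕ}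
    (h : ∀ v ≤ t, coeff v Q = 0) : coeff t (H * Q) = 0 := by
  classical
  rw [coeff_mul]
  refine sum_eq_zero fun x hx => ?_
  have hsum : x.1 + x.2 = t := Finset.HasAntidiagonal.mem_antidiagonal.mp hx
  rw [h x.2 (by rw [← hsum]; exact le_add_self), mul_zero]

/-- If `Q` vanishes in all degrees `< |t|`, then `coeff_t (H · Q) = H(0) · coeff_t Q`. [folklore] -/
theorem coeff_mul_of_forall_degree_lt {H Q : MvPolynomial (Fin 4) K} {t : Fin 4 →₀ ℕ}
    (h : ∀ v : Fin 4 →₀ ℕ, v.degree < t.degree → coeff v Q = 0) : coeff t (H * Q) = constantCoeff H * coeff t Q := by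
  classical
  rw [coeff_mul, Finset.sum_eq_single ((0 : Fin 4 →₀ ℕ), t)]
  · rw [constantCoeff_eq]
  · rintro ⟨u, v⟩ hx hne
    have hsum : u + v = t := Finset.HasAntidiagonal.mem_antidiagonal.mp hx
    have hu : u ≠ 0 := by rintro rfl; apply hne; rw [zero_add] at hsum; rw [hsum]
    have hv : v.degree < t.degree := by
      have hdeg := congrArg Finsupp.degree hsum
      rw [map_add] at hdeg
      have : u.degree ≠ 0 := fun h0 => hu ((Finsupp.degree_eq_zero_iff u).mp h0)
      omega
    rw [h v hv, mul_zero]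
  · intro ht
    exact absurd (Finset.HasAntidiagonal.mem_antidiagonal.mpr (zero_add t)) ht

/-- An exponent of degree `1` off `f` carries a vanishing coefficient of `G` when the linear part of `G` vanishes off `f`;
with `G(0) = 0` and no `x_f`-term: `G ∈ 𝔪₀²` coefficientwise. [folklore] -/
theorem coeff_eq_zero_of_degree_lt_two {f : Fin 4} {G : MvPolynomial (Fin 4) K} (hG0 : constantCoeff G = 0)
    (hG1 : coeff (Finsupp.single f 1) G = 0) (hlin : ∀ i, i ≠ f → coeff (Finsupp.single i 1) G = 0)
    (v : Fin 4 →₀ ℕ) (hv : v.degree < 2) : coeff v G = 0 := by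
  rcases Nat.lt_or_ge v.degree 1 with h0 | h1
  · rw [(Finsupp.degree_eq_zero_iff v).mp (by omega), ← constantCoeff_eq, hG0]
  · obtain ⟨l, rfl⟩ := IsolationCert.exists_eq_single_of_degree_eq_one (show v.degree = 1 by omega)
    by_cases hl : l = f
    · subst hl; exact hG1
    · exact hlin l hl

/-- The `x_f`-free monomials of `G` have degree `≥ 2` once `G(0) = 0` and the linear part of `G` vanishes off `f`.
[folklore] -/
theorem two_le_degree_of_linearFree {f : Fin 4} {G : MvPolynomial (Fin 4) K} (hG0 : constantCoeff G = 0)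
    (hlin : ∀ i, i ≠ f → coeff (Finsupp.single i 1) G = 0) :
    ∀ dd ∈ G.support, dd f = 0 → 2 ≤ dd.degree := by
  intro dd hdd hddf
  by_contra hlt
  rcases Nat.lt_or_ge dd.degree 1 with h0 | h1
  · have : dd = 0 := (Finsupp.degree_eq_zero_iff dd).mp (by omega)
    subst this
    exact (mem_support_iff.mp hdd) (by rw [← constantCoeff_eq, hG0])
  · obtain ⟨l, rfl⟩ := IsolationCert.exists_eq_single_of_degree_eq_one (show (dd : Fin 4 →₀ ℕ).degree = 1 by omega)
    have hl : l ≠ f := by rintro rfl; rw [Finsupp.single_eq_same] at hddf; exact one_ne_zero hddf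
    exact (mem_support_iff.mp hdd) (hlin l hl)

/-- **Supports of the powers of `G`**: if `G(0) = 0` and `G` has no `x_f`-term, every monomial `v` of `G^k` has `|v| ≥ k`,
and `|v| = k` forces `v_f = 0` (the degree-`k` part of `G^k` is the `k`-th power of the `x_f`-free linear part). [folklore] -/
theorem support_pow_of_linearFree {f : Fin 4} {G : MvPolynomial (Fin 4) K} (hG0 : constantCoeff G = 0)
    (hG1 : coeff (Finsupp.single f 1) G = 0) (k : ℕ) :
    ∀ v ∈ (G ^ k).support, k ≤ v.degree ∧ (v.degree = k → v f = 0) := by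
  classical
  induction k with
  | zero =>
    intro v hv
    rw [pow_zero] at hv
    have hv0 : v = 0 := by
      have h := support_monomial_subset (hv : v ∈ (monomial (0 : Fin 4 →₀ ℕ) (1 : K)).support)
      exact Finset.mem_singleton.mp h
    subst hv0
    exact ⟨le_rfl, fun _ => rfl⟩
  | succ k ih =>
    intro v hv
    rw [pow_succ] at hv
    obtain ⟨v₁, hv₁, v₂, hv₂, rfl⟩ := Finset.mem_add.mp (support_mul _ _ hv)
    obtain ⟨hk₁, hf₁⟩ := ih v₁ hv₁
    have h2 : 1 ≤ v₂.degree ∧ (v₂.degree = 1 → v₂ f = 0) := by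
      have hne : v₂ ≠ 0 := by
        rintro rfl; exact (mem_support_iff.mp hv₂) (by rw [← constantCoeff_eq, hG0])
      have h1 : 1 ≤ v₂.degree := by
        by_contra h; exact hne ((Finsupp.degree_eq_zero_iff v₂).mp (by omega))
      refine ⟨h1, fun hdeg => ?_⟩
      obtain ⟨l, rfl⟩ := IsolationCert.exists_eq_single_of_degree_eq_one hdeg
      have hl : l ≠ f := by rintro rfl; exact (mem_support_iff.mp hv₂) hG1
      exact Finsupp.single_eq_of_ne hl.symm
    refine ⟨by rw [map_add]; omega, fun hdeg => ?_⟩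
    rw [map_add] at hdeg
    rw [Finsupp.add_apply, hf₁ (by omega), h2.2 (by omega)]

/-- **The remainder past the cone**: if every monomial of `P` has degree `≥ o` and the only one of degree `o` is `m⋆`, then
`P − coeff_{m⋆} P · x^{m⋆} ∈ 𝔪₀^{o+1}`. [folklore] -/
theorem sub_monomial_mem_pow {P : MvPolynomial (Fin 4) K} {o : ℕ} {ms : Fin 4 →₀ ℕ}
    (hP : ∀ m ∈ P.support, o ≤ m.degree) (hcone : ∀ m ∈ P.support, m.degree = o → m = ms) :
    P - monomial ms (coeff ms P) ∈ originIdeal K ^ (o + 1) := by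
  classical
  rw [IsolationCert.mem_originIdeal_pow_iff]
  intro dd hdd
  rw [coeff_sub, coeff_monomial]
  split_ifs with h
  · subst h; exact sub_self _
  · rw [sub_zero]
    by_contra hne
    have hmem := mem_support_iff.mpr hne
    exact h (hcone dd hmem (le_antisymm (by have := hP dd hmem; omega) (hP dd hmem))).symm

/-- **Coefficients through a re-presentation**: `Q = clean_q(V · θ P) + D`, `D ∈ 𝔪₀ᴹ`, `|t| < M`, `t` not a `q`-th power,
and `θ P` without monomials strictly below `t` ⇒ `coeff_t Q = V(0) · coeff_t θ(P)` (any substitution `θ`).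
[cite: Hauser2010, §§F–G (cleaning)] [folklore] -/
theorem coeff_of_rel_of_lower (q : ℕ) {θ : Fin 4 → MvPolynomial (Fin 4) K} {V D Q P : MvPolynomial (Fin 4) K} {M : ℕ}
    (hD : D ∈ originIdeal K ^ M) (hrel : Q = deletePthPowers q (V * aeval θ P) + D) {t : Fin 4 →₀ ℕ}
    (htM : t.degree < M) (htq : ¬ IsPthPowerExponent q t) (hlow : ∀ b ≤ t, b ≠ t → coeff b (aeval θ P) = 0) :
    coeff t Q = constantCoeff V * coeff t (aeval θ P) := by
  classical
  have hDt : coeff t D = 0 := (IsolationCert.mem_originIdeal_pow_iff M D).mp hD _ htM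
  rw [hrel, coeff_add, hDt, add_zero, coeff_deletePthPowers, if_neg htq, coeff_mul,
    Finset.sum_eq_single ((0 : Fin 4 →₀ ℕ), t)]
  · rw [constantCoeff_eq]
  · rintro ⟨u, b⟩ hx hne
    have hsum : u + b = t := Finset.HasAntidiagonal.mem_antidiagonal.mp hx
    have hu : u ≠ 0 := by rintro rfl; apply hne; rw [zero_add] at hsum; rw [hsum]
    have hb : b ≤ t := by rw [← hsum]; exact le_add_self
    have hbt : b ≠ t := by
      intro hbt; apply hu
      rw [hbt] at hsum
      simpa using hsum
    rw [hlow b hb hbt, mul_zero]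
  · intro ht
    exact absurd (Finset.HasAntidiagonal.mem_antidiagonal.mpr (zero_add t)) ht

/-! ## §2 The coefficient one `G` below the top of `E · (x_f e_f + G)^d` -/

/-- **One factor `G` below the top.**  For `w` off `f` (`w_f = 0`), `d ≥ 1`:
`coeff_{(d-1)·e_f + w} (E · (x_f e_f + G)^d) = d · E(0) · e_f(0)^{d-1} · coeff_w G`, provided `G` vanishes in degrees
`< |w|` and every product `H · G^k`, `2 ≤ k ≤ d`, misses the exponents `v` with `|v| + 1 = k + |w|`, `v_f + 1 = k`
(binomial expansion; the terms with `k ≥ 2` factors `G` are the consumer's `hvan`). [folklore] -/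
theorem coeff_pred_mul_X_mul_add_pow (f : Fin 4) (E ef G : MvPolynomial (Fin 4) K) {d : ℕ} (hd : 1 ≤ d)
    {w : Fin 4 →₀ ℕ} (hwf : w f = 0) (hlow : ∀ v : Fin 4 →₀ ℕ, v.degree < w.degree → coeff v G = 0)
    (hvan : ∀ (H : MvPolynomial (Fin 4) K) (k : ℕ) (v : Fin 4 →₀ ℕ), 2 ≤ k → k ≤ d →
      v.degree + 1 = k + w.degree → v f + 1 = k → coeff v (H * G ^ k) = 0) :
    coeff (Finsupp.single f (d - 1) + w) (E * (X f * ef + G) ^ d) =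
      d * (constantCoeff E * constantCoeff ef ^ (d - 1) * coeff w G) := by
  classical
  set t := Finsupp.single f (d - 1) + w with ht
  have htf : t f = d - 1 := by rw [ht, Finsupp.add_apply, Finsupp.single_eq_same, hwf, add_zero]
  have htdeg : t.degree = (d - 1) + w.degree := by rw [ht, map_add, Finsupp.degree_single]
  have hchoose : d.choose (d - 1) = d := by
    rw [← Nat.choose_symm (Nat.sub_le d 1), Nat.sub_sub_self hd, Nat.choose_one_right]
  -- binomial expansion, term by term
  have hterm : ∀ m : ℕ, E * ((X f * ef) ^ m * G ^ (d - m) * (d.choose m : MvPolynomial (Fin 4) K)) =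
      C (d.choose m : K) * (monomial (Finsupp.single f m) (1 : K) * (E * ef ^ m * G ^ (d - m))) := by
    intro m
    rw [mul_pow, X_pow_eq_monomial, ← map_natCast (C : K →+* MvPolynomial (Fin 4) K)]
    ring
  rw [add_pow, mul_sum, coeff_sum]
  simp_rw [hterm, coeff_C_mul, coeff_monomial_mul']
  rw [Finset.sum_eq_single (d - 1)]
  · -- the main term `m = d − 1`: one factor `G`
    rw [if_pos (by rw [ht]; exact le_self_add), one_mul, show t - Finsupp.single f (d - 1) = w from
      by rw [ht, add_tsub_cancel_left], show d - (d - 1) = 1 by omega, pow_one,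
      coeff_mul_of_forall_degree_lt hlow, map_mul, map_pow, hchoose]
  · -- the other terms
    intro m hm hmd
    have hmle : m ≤ d := Nat.lt_succ_iff.mp (Finset.mem_range.mp hm)
    split_ifs with hle
    · rw [one_mul]
      have hmf : m ≤ d - 1 := by
        have := Finsupp.single_le_iff.mp hle; rw [htf] at this; exact this
      have hk2 : 2 ≤ d - m := by omega
      -- the exponent `t − m·e_f`
      have hsplit : t - Finsupp.single f m + Finsupp.single f m = t := tsub_add_cancel_of_le hle
      have hdegv : (t - Finsupp.single f m).degree + 1 = (d - m) + w.degree := by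
        have h := congrArg Finsupp.degree hsplit
        rw [map_add, Finsupp.degree_single, htdeg] at h
        omega
      have hvf : (t - Finsupp.single f m) f + 1 = d - m := by
        rw [Finsupp.tsub_apply, htf, Finsupp.single_eq_same]; omega
      rw [hvan (E * ef ^ m) (d - m) _ hk2 (Nat.sub_le d m) hdegv hvf, mul_zero]
    · rw [mul_zero]
  · intro h
    exact absurd (Finset.mem_range.mpr (by omega)) h

/-- The `k ≥ 2` terms miss the target when `|w| = 1`: a monomial `v` of `H · G^k` with `|v| = k` and `v_f = k − 1 ≥ 1` does
not exist (`G^k` has only `x_f`-free monomials in degree `k`). [folklore] -/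
theorem hvan_of_linearFree {f : Fin 4} {G : MvPolynomial (Fin 4) K} (hG0 : constantCoeff G = 0)
    (hG1 : coeff (Finsupp.single f 1) G = 0) (H : MvPolynomial (Fin 4) K) (k : ℕ) (v : Fin 4 →₀ ℕ) (hk : 2 ≤ k)
    (hdeg : v.degree + 1 = k + 1) (hvf : v f + 1 = k) : coeff v (H * G ^ k) = 0 := by
  refine coeff_mul_eq_zero_of_forall_le fun v' hv' => ?_
  by_contra hne
  obtain ⟨hk', hf'⟩ := support_pow_of_linearFree hG0 hG1 k v' (mem_support_iff.mpr hne)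
  have heq : v' = v := FrameChange.eq_of_le_of_degree_le hv' (by omega)
  subst heq
  have := hf' (by omega)
  omega

/-- The `k ≥ 2` terms miss the target when `|w| = 2` and `G ∈ 𝔪₀²`: `G^k ∈ 𝔪₀^{2k}` and `|v| = k + 1 < 2k`. [folklore] -/
theorem hvan_of_mem_sq {G : MvPolynomial (Fin 4) K} (hG2 : ∀ v : Fin 4 →₀ ℕ, v.degree < 2 → coeff v G = 0)
    (H : MvPolynomial (Fin 4) K) (k : ℕ) (v : Fin 4 →₀ ℕ) (hk : 2 ≤ k) (hdeg : v.degree + 1 = k + 2) :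
    coeff v (H * G ^ k) = 0 := by
  have hGk : G ^ k ∈ originIdeal K ^ (2 * k) := by
    rw [pow_mul]
    exact Ideal.pow_mem_pow ((IsolationCert.mem_originIdeal_pow_iff 2 G).mpr hG2) k
  refine coeff_mul_eq_zero_of_forall_le fun v' hv' => ?_
  refine (IsolationCert.mem_originIdeal_pow_iff _ _).mp hGk v' ?_
  have : v'.degree ≤ v.degree := by
    rcases eq_or_ne v' v with rfl | hne
    · exact le_rfl
    · exact (degree_lt_of_le_of_ne hv' hne).le
  omega

end SwapNorm

end Summit.ResolutionOfSingularities.ResolutionOfSingularities.Theorems.PIDim4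

end
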